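import Mathlib
import HarnessLib
import HarnessLib.Audit
import Summits.ValiantsHypothesis.Statement
import Literature.Computability.AlgebraicComplexity.DeterminantalComplexity
import Literature.Computability.AlgebraicComplexity.ValiantConjectureProofs
import HarnessLib.Audit.Status.Attr

/-!
Route: PermanentalCones

DORMANT since 2026-08-26T10:51:47Z (reconciler: no traction for 8.4 d (last activity item-evidence-added at 2026-08-18T01:33:51Z); parked, not closed — `ledger route dormant route-ValiantsHypothesis-PermanentalCones --off` to reactivate) — unstaffed, not closed; items shared with open routes are served there. `ledger route dormant <id> --off` reactivates.

# Route PermanentalCones — permanental hyperbolicity cones need large SDP shadows, while VP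
hyperbolicity cones (hyperbolic determinantal pencils) have quasi-polynomial ones

X = H+ ∧ HT (card permanental-hyperbolicity-cones-fork, the H+ branch of its fork). The PERMANENTAL
POLYNOMIALS are
Q_{n,r,Y}(s) := per[Y_{rows<r} ; s ; … ; s] ∈ ℝ[s_1..s_n] (r constant rows taken from Y ∈
ℝ^{n×n}_{≥0}, the other n−r rows
all equal to the variable row s) = (n−r)!·D_{y_0}⋯D_{y_{r−1}} e_n(s) = (n−r)!·Σ_{|T|=n−r}
per(Y_{[r),[n]∖T}) s^T: mixed Renegar
derivatives of the orthant polynomial in nonnegative directions, real stable, hyperbolic w.r.t. 𝟙,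
projections of per_n, with
permanents as coefficients (Gurvits' dictionary). H+ (PermanentalConeHard): for some nonnegative
Y_n, r_n the closed hyperbolicity
cones Λ_+(Q_n, 𝟙) = {x : Q_n(x + τ𝟙) ≠ 0 ∀ τ > 0} admit no lifted-LMI (spectrahedral SHADOW)
description of quasi-polynomial
size. HT (HyperbolicVPShadow, the complexity form of the projected Lax conjecture): every hyperbolic
p-family whose
complexification is in VP_ℂ has hyperbolicity cones that are spectrahedral shadows of
quasi-polynomial size. Since Q_n is a
projection of per_n, per ∈ VP_ℂ would put (Q_n) in VP_ℂ and HT would contradict H+; so X ⇒ per ∉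
VP_ℂ ⇒ VP_ℂ ≠ VNP_ℂ.
Lean: `PermanentalConeHard ∧ HyperbolicVPShadow`

## Assembly
Bookkeeping over PROVED tree facts (hub composition checked sorry-free in the planner's
Sketch.lean): assume H+ and HT; by the hub
theorem Summit.ValiantsHypothesis.Hub.valiantsHypothesis_of_not_isVPFamily_per with
mem_VP_ofFintype_iff_holds and
perFamily_mem_VNP_holds ℂ it suffices to refute IsVPFamily (per_n over ℂ). If per ∈ VP_ℂ,
PermanentalInVP's argument puts
the witness family (Q_n) of H+ in VP_ℂ; Q_n is homogeneous (degree n − r n) and hyperbolic w.r.t. 𝟙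
by the H+ clause
(z·1 = z, x + τ•𝟙 = (x_j + τ)_j by simp); HT with v = id, f = Q, e_n = 𝟙 gives c and shadows of size
≤ 2^((log₂ n + c)^c)
for every n; H+ at this c gives n where no such shadow exists — contradiction.

Rationale: WHY THIS LINE. The permanent sits INSIDE the hyperbolic world at polynomial degree: per[Y;
s^{(n−r)}] is a polarised hyperbolic derivative of a
product of linear forms (arXiv:math/0510452, the engine of Gurvits' van der Waerden proof), so "is
per a small shadow of det"
acquires a convex-geometric form — is the hyperbolicity cone of a permanental polynomial a small
shadow of a PSD cone — on
which semidefinite-representation technology acts: upper bounds for single-direction derivative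
cones (arXiv:1208.1443 Thm 1,
size O(min{k,n−k}n²); arXiv:1204.2997), size lower bounds for cones (arXiv:1711.11497 Thm 2,
sections, generic perturbations of
e_d; psd-rank arXiv:1411.6317, arXiv:1111.3164), existence of shadows (arXiv:1208.0441;
arXiv:2509.17121, SOC-representable,
no size control). The converse bridge is in print for SECTIONS: a small spectrahedral representation
of the cone of an
irreducible hyperbolic h puts h in VP by Kaltofen factoring, so VP ≠ VNP forces superpolynomial
sections for Amini's matching
polynomial (doi:10.1145/3373207.3404010 Thm 1.1); this line runs the FORWARD bridge for SHADOWS,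
where blindness (H−) is
consistent with VH and therefore a genuine fork, and where the transfer is not the generalized Lax
conjecture. Imported
areas: hyperbolic programming / real algebraic geometry of hyperbolicity cones, lifts of convex sets
(Yannakakis–GPT), and
the tree's proved normal form VP ⊆ qp-det (isQPBounded_determinantalComplexity_of_isVPFamily_holds),
which turns HT into a
statement about real matrix pencils with hyperbolic determinant (HyperbolicDetShadow). No prior
route of the sub touches
hyperbolicity or SDP size (FreeEnergyLift lifts the epigraph of log per(e^u), a different convex
object with a
monotone-flavoured transfer); the negatives index is empty.

RANKED CRUXES. #2 PermanentalConesEasy (crux) — FORK DECIDER (card H−, blindness): there is c such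
that for all n, r and all entrywise nonnegative Y ∈ ℝ^{n×n} the closed cone {x ∈ ℝ^n : Q_{n,r,Y}(x +
τ𝟙) ≠ 0 for all τ > 0} equals {x : ∃ y ∈ ℝ^p, A(x,y) + B ⪰ 0} for some m ≤ n^c + c, some p, a linear
A into m×m real matrices and a constant B. Proving it extends Saunderson–Parrilo from one derivative
direction to mixed nonnegative directions and KILLS the route (EasyRefutesHard; barrier entry
"HyperbolicBlindness"); refuting it is the first rung of H+ (a superpolynomial shadow-size lower
bound for permanental cones). [difficulty: L] (why it might fail: Every poly-size construction (SP
Thm 1 via e_{n−1} = n·det(VᵀDiag(x)V), Brändén) runs on symmetric-function identities; with ≥ 2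
distinct directions the weights are permanents of Y-minors (injective maps), exactly where
product/derivative tricks produce products (maps with repetition).) [arXiv:1208.1443,
arXiv:1204.2997, arXiv:math/0510452, arXiv:1711.11497]
#3 HyperbolicDetShadow (crux) — TRANSFER, PENCIL FORM (uniform complexity version of the projected
Lax conjecture): there is c such that for every real N×N matrix M of affine-linear forms in s_1..s_n
whose determinant f is homogeneous and hyperbolic w.r.t. e (f(e) ≠ 0 and z ↦ f(x + z e) has only
real zeros for all real x), the closed cone {x : f(x + τe) ≠ 0 ∀ τ > 0} is a spectrahedral shadow {x
: ∃ y, A(x,y) + B ⪰ 0} of size m ≤ 2^((log₂ N + c)^c). Equivalently (M(e) normalised): linear spaces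
of real matrices with only real eigenvalues have eigenvalue-nonnegativity cones of quasi-polynomial
lifted-LMI size. Implies HyperbolicVPShadow through the proved tree facts VP ⇒ dc quasi-polynomial
and realification (DetToVP). [difficulty: open-problem] (why it might fail: Contains the projected
Lax conjecture (every hyperbolic f is det of an affine pencil), open beyond Nash-smooth cones
(Netzer–Sanyal, Scheiderer 2025: no size control); GKKP symmetrisation is never definite; one pencil
family with hyperbolic determinants and non-qp shadow cones kills it.) [arXiv:1208.0441,
arXiv:2509.17121, arXiv:1007.3804, arXiv:1612.07048, arXiv:math/0306180, arXiv:1308.5560]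
#4 PermanentalConeHard (crux) — H+ (card K1, H+ branch): there are r : ℕ → ℕ and entrywise
nonnegative Y_n ∈ ℝ^{n×n} such that every Q_n := per[(Y_n)_{rows<r n}; s^{(n−r n)}] is hyperbolic
w.r.t. 𝟙 (Q_n(𝟙) ≠ 0 and only real zeros of z ↦ Q_n(x + z𝟙)) and for every c there is n such that
the closed cone {x : Q_n(x + τ𝟙) ≠ 0 ∀ τ > 0} has NO description {x : ∃ y, A(x,y) + B ⪰ 0} with m ≤
2^((log₂ n + c)^c). Existential in Y_n on purpose: Q_n is a projection of per_n for ANY constants,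
so non-uniformity absorbs explicitness (PermanentalInVP). [deps: PermanentalConesEasy] [difficulty:
open-problem] (why it might fail: H− may hold (blindness); and no method bounds SHADOW size
super-logarithmically for any explicit non-polyhedral cone (LRS is polyhedral, algebraic-degree
bounds are O(log), RRSW counts dimension of generic perturbations — useless for an n²-parameter
family).) [arXiv:1711.11497, arXiv:1411.6317, arXiv:1111.3164, arXiv:1705.06996, arXiv:1612.07048,
doi:10.1145/3373207.3404010]
#5 HyperbolicVPShadow (crux) — HT, FAMILY FORM (card K2; the weakest transfer the assembly
consumes): for every p-family f_n ∈ ℝ[s_1..s_{v(n)}] of homogeneous polynomials hyperbolic w.r.t.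
directions e_n whose complexification is a VP_ℂ family, there is c with: for all n the closed cone
{x : f_n(x + τ e_n) ≠ 0 ∀ τ > 0} is a spectrahedral shadow of size m ≤ 2^((log₂ n + c)^c). Prove it
via HyperbolicDetShadow + DetToVP; refute it by a VP family (e.g. few-direction derivative cones
D_{y}D_{y'}e_n, r = O(log n) permanental families, pencil determinants) with non-qp shadow cones.
[deps: HyperbolicDetShadow] [difficulty: open-problem] (why it might fail: ¬HT = a VP family with
hard shadow cones is the MonotoneGap analogue; hyperbolicity is invisible gate by gate, so no
inductive proof exists, and constant families already make HT contain the projected Lax conjecture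
(open for singular cones).) [arXiv:1711.11497, arXiv:1208.0441, arXiv:2509.17121,
doi:10.1145/3373207.3404010, Burgisser2000]
#9 EasyRefutesHard (support) — kill chain: uniform polynomial-size shadows for all nonnegative
permanental cones refute H+ (n^c + c ≤ 2^((log₂ n + c')^c') for a suitable c', instantiate at the
witness family). [difficulty: provable-now] [arXiv:1208.1443]
#9 DetToVP (support) — pencil form ⇒ family form: for a real family f with complexification in VP_ℂ,
dc_ℂ(f_n) ≤ 2^((log₂ n + a)^a) (isQPBounded_determinantalComplexity_of_isVPFamily_holds,
hasDetRepr_determinantalComplexity_holds, both proved); realify the complex affine pencil P + iQ to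
the real 2N×2N pencil [[P, −Q],[Q, P]] whose determinant is f_n² (block-triangularisation over ℂ);
f_n² is homogeneous, hyperbolic w.r.t. e_n with the same closed cone as f_n; apply
HyperbolicDetShadow and compose the two quasi-polynomial bounds. [difficulty: provable-now]
[BurgisserClausenShokrollahi1997, Burgisser2000, arXiv:1007.3804]
#9 PermanentalHyperbolic (support) — Gårding/Lieb–Sokal for the witnesses (card P1): for entrywise
nonnegative Y, Q = per[Y_{rows<r}; s^{(n−r)}] is real stable (Π s_j is stable; D_y = Σ y_j ∂_j with
y ≥ 0 preserves stability or kills the polynomial: for Im s > 0 the zeros t_k of t ↦ Q(s + t y) have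
Im t_k < 0 and D_yQ(s) = −Q(s)·Σ 1/t_k ≠ 0), hence if Q(𝟙) ≠ 0 then z ↦ Q(x + z𝟙) has only real
zeros (conjugation symmetry for Im z < 0). [difficulty: provable-now] [arXiv:0911.3569,
arXiv:0809.0401, arXiv:math/0510452]
#9 PermanentalInVP (support) — projection closure (card P1, completeness direction not needed): the
complexification of per[(Y_n)_{rows<r n}; s^{(n−r n)}] is aeval of perPoly (Fin n) ℂ under (i,j) ↦ C
(Y n i j) (i < r n) / X j (else), a Valiant projection with t = id; it is a p-family (n variables,
total degree ≤ n); hence per ∈ VP_ℂ (IsVPFamily) gives IsVPFamily of the permanental family for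
EVERY choice of r, Y (IsVPFamily.of_isPProjection_holds). [difficulty: provable-now] [Valiant1979,
Burgisser2000]

TWO-LAYER PLAN. PermanentalConesEasy ⇐ TwoDirections (cones of D_{y'}D_y e_n = Σ_{a<b}(w_a + w_b)
s^{[n]∖{a,b}}-type, poly size) → DirectionInduction
(r ↦ r+1 at polynomial cost) → PermanentalConesEasy. HyperbolicVPShadow ⇐ HyperbolicDetShadow →
DetToVP (filed). HyperbolicDetShadow ⇐
RealSpectrumNormalForm (M(e) = I: spaces of real matrices with real spectrum) → BlockSymmetrisable
case → general. PermanentalConeHard ⇐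
either NotAShadow (a Scheiderer-type obstruction for one singular permanental cone, which gives H+
outright) or SlackPsdRank (GPT
factorisation of the cone's slack operator (x, ℓ) ↦ ℓ(x) + a psd-rank lower bound) — k ≤ 3 children
each, filed only after rank 2 closes.

KILL CRITERIA. PermanentalConesEasy PROVED ⇒ EasyRefutesHard refutes PermanentalConeHard ⇒ close
`refuted:PermanentalConeHard` and hand the theorem to
the barrier catalogue as Literature.Barriers.ValiantsHypothesis.HyperbolicBlindness ("shadow size of
hyperbolicity cones of VNP-complete
hyperbolic families is uniformly polynomial: Lax-side convex invariants cannot witness VH"); no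
pivot to sections (there the transfer is the
generalized Lax conjecture with size bounds, and doi:10.1145/3373207.3404010 shows section hardness
is merely equivalent-in-spirit to VH).
HyperbolicVPShadow refuted (a VP family with non-qp shadow cones, or a hyperbolicity cone that is no
shadow at all) ⇒ HyperbolicDetShadow
dies with it; the only pivot is HT restricted to Nash-smooth cones plus a Nuij smoothing of the
permanental family with η-robust lower
bounds — a new route, so close `refuted:HyperbolicVPShadow`. per ∉ VP proved elsewhere moots the
route; VP = VNP refutes H+ ∧ HT.

NOT DECOMPOSED YET. Signed or complex direction matrices Y (hyperbolicity then not automatic); the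
t-side pullbacks P_{X,k}(t) of the card (linear preimages,
same shadow size); η-approximate representations and block-size (sxdeg) refinements; smooth
(Nuij-perturbed) variants; the exact
polynomial in PermanentalConesEasy (n^c + c is the coarse form); uniform-in-complexity versions of
HT; definitions hyperbolicityCone /
IsHyperbolic / spectrahedral-shadow size as Literature notions (requested after open; items restate
verbatim over them later).

CHEAPEST FALSIFIER. Structural, for the rank-2 item: write the two-direction cone Λ_+(D_{y'}D_y e_n,
𝟙) (after scaling, the cone of
Σ_{a<b}(w_a + w_b)·Π_{j∉{a,b}} s_j, w = y'/y > 0) as a coordinate section/projection of a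
single-direction derivative relaxation of
a polyhedral cone with poly(n) facets, or give it an LMI generalising e_{n−1}(x) = n·det(VᵀDiag(x)V)
(arXiv:1208.1443 §2); success
that iterates in the number of directions at polynomial cost proves PermanentalConesEasy and kills
the line. Checked here only in
print: arXiv:1208.1443 has no mixed-direction statement (grep "mixed": 0), arXiv:1711.11497 bounds
sections only (Thm 2), and
r = O(log n) directions give VP families (Ryser), so hardness can only start beyond logarithmically
many distinct directions —
consistent with both branches. A kit SDP-feasibility search for small LMIs of Λ_+(Q) at n = 6, r =
3, random 0/1 Y is the
refuter's first computation (not run: planner seat, no kit).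

NUMBERS. Single direction: Λ_+(e_k) sections of size O(n^{k−1}) (arXiv:1204.2997), shadows of size
O(min{k,n−k}·n²) (arXiv:1208.1443 Thm 1);
k ≤ 2 (r ≥ n−2): Lorentz cones, size ≤ n. Lower bounds in print: sections, generic binary
perturbations of e_d, B ≥ (n/d)^{κd} even
η = n^{−4nd}-approximately (arXiv:1711.11497 Thm 2); explicit cones: linear only, or conditional on
VP ≠ VNP (doi:10.1145/3373207.3404010
Thm 1.1, Amini's matching polynomial, sections); shadows: nothing super-logarithmic for any explicit
non-polyhedral cone. Transfer side:
VP ⇒ dc(f_n) ≤ 2^{17A²(log₂ n + 1)²} (tree,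
isQPBounded_determinantalComplexity_of_isVPFamily_holds); realification doubles N.
Witness range: r = O(log n) ⇒ Q ∈ VP (r-row permanents by Ryser in 2^r·poly); r = ⌊n/2⌋ ⇒ (Q_{2m,m})
VNP-complete (per_m = Q at
s = 1_{[m]}0_{(m,2m]} up to m!). Items at open: 9 (4 crux, 4 support, 1 assembly).

DEFINITION REQUESTS. After open (async): `IsHyperbolic (f : MvPolynomial σ ℝ) (e : σ → ℝ)`,
`hyperbolicityCone f e : Set (σ → ℝ)` (closed cone
{x | ∀ τ > 0, eval (x + τ•e) f ≠ 0}) and `IsSpectrahedralShadowOfSize (K : Set (σ → ℝ)) (m : ℕ)`,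
topic
Literature/AlgebraicGeometry/RealAlgebraic (none in Mathlib: lean search
hyperbolicityCone|spectrahedr|IsRealStable → 0 decls), so
that the five cone-bearing items can be restated verbatim over named notions. Cite facts wanted
later (layer 2): Saunderson–Parrilo
Thm 1; Netzer–Sanyal; GPT Thm 2.4 for cones.

Novelty: Searches (2026-08-15): `lit search "conditional lower bounds spectrahedral representation explicit
hyperbolicity cones Oliveira"` (local 2
citing docs + doi:10.1145/3373207.3404010, read pp. 1–2 from the author's copy); `lit search
--source zbmath "hyperbolic polynomials
determinantal representations"` (15: Netzer–Thom ×2, Plaumann–Vinzant, KPV interlacers,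
Shamovich–Vinnikov arXiv:1410.2826, Kummer
arXiv:1308.5560, Knese, Saunderson arXiv:1904.00491 — none on representation SIZE vs circuit size);
`lit search --source zbmath
"hyperbolicity cones spectrahedral shadow size lower bound VNP permanent"` (0); `lit search --source
arxiv "Scheiderer spectrahedral
shadows"` (3: arXiv:1612.07048, arXiv:2206.06312, arXiv:2509.17121 — read Thm 1.1:
SOC-representability of Nash-smooth hyperbolicity
cones, no size bound); `lit galaxy search "spectrahedral representation of explicit hyperbolicity
cones" --star all` (1: Schweighofer
arXiv:1907.13611 relaxations); `lit galaxy search "hyperbolicity cone of the permanent" --star all`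
(0); `lit read arxiv:1711.11497`
(Thm 2 verbatim, sections only, remark on SP projections); `lit read arxiv:1208.1443` (Thm 1
verbatim); grep of all 39 Theses of the
sub for hyperbolic|spectrahedral|Lax|semidefinite (FreeEnergyLift, SymPencil, RefutationDegree
mention SDP only in novelty text);
`ledger negatives --problem ValiantsHypothesis` (0). openalex/s2 legs rate-limited (429) — recorded.
Nearest prior art found: doi:10.1145/3373207.3404010 (Oliveira, ISSAC 20  [refs: 10.1145/3373207.3404010, 1410.2826, 1308.5560, 1904.00491, 1612.07048, 2206.06312, 2509.17121, 1907.13611, 1711.11497, 1208.1443, math/0510452, doi:10.1145/3373207.3404010, arxiv:1711.11497, arxiv:1208.1443]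

Barriers (technique_class: hyperbolic-programming, sdp-lift-size, convex-shadow-transfer): - technique_class: hyperbolic-programming, sdp-lift-size, convex-shadow-transfer
- Literature.Barriers.ValiantsHypothesis.MonotoneGap: the analogous danger — a VP family whose
convex invariant is provably large — is exactly ¬HyperbolicVPShadow; unlike monotone size, shadow
size is not known to be large for ANY VP hyperbolic family (RRSW's hard cones are generic
perturbations, Oliveira's are VNP-hard), so the gap is open rather than catalogued, and the route
files the place it would first show (few-direction derivative cones) as the refutation target of
rank 5; the bet is HT.
- Literature.Barriers.ValiantsHypothesis.AlgebraicNaturalProofs: "Λ_+(Q_n) has no lifted LMI of size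
m" is an ∃∀ statement over real representation data (a psd-factorisation rank of the cone's slack
operator), not the vanishing of a VP-constructible polynomial in the coefficients of Q_n, so the FSV
format does not apply formally; conceded that a proof of H+ through a finite rank condition on
finitely many slack values could re-enter the conditional barrier's scope.
- Literature.Barriers.ValiantsHypothesis.RankMethods: shadow size is a CONE (psd) rank of an
infinite slack operator, nonlinear and sign-sensitive, not the rank of a linear image of the
coefficient vector; EGOW's caps on rank-method separations do not apply — caveat: the only psd-rank
lower-bound engine (LRS) passes through SOS degree, whose analogue for non-polyhedral cones is
missing.
- Literature.Barriers.ValiantsHypothesis.RankLifting: same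

History (route lifecycle, newest last):
- 2026-08-26T10:51:47Z · DORMANT — reconciler: no traction for 8.4 d (last activity item-evidence-added at 2026-08-18T01:33:51Z); parked, not closed — `ledger route dormant route-ValiantsHypothes (operator:999:2387933)

sub-problem: ValiantsHypothesis · status: dormant · opened planner-plancard-ValiantsHypothesis-ValiantsH-acc0afdb-0 2026-08-15T13:26:32Z · rev 1 · ledger route-ValiantsHypothesis-PermanentalCones
GENERATED by the gate from the ledger (D-0016/17). Provers cite these decls: `theorem foo : Summit.ValiantsHypothesis.ValiantsHypothesis.Theses.PermanentalCones.<Decl> := …` in Summits/ValiantsHypothesis/ValiantsHypothesis/Theorems/<Name>.lean.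
-/

namespace Summit.ValiantsHypothesis.ValiantsHypothesis.Theses.PermanentalCones

open scoped BigOperators Topology Manifold Classical MeasureTheory ProbabilityTheory Matrix InnerProductSpace ComplexConjugate ContinuousMap
open Filter Set Function TopologicalSpace MeasureTheory

attribute [summit_statement] _root_.ValiantsHypothesis

open Literature.PNP

/-- item stmt-ValiantsHypothesis-8652 · crux · rank 2 · open · by planner
why it might fail: Every poly-size construction (SP Thm 1 via e_{n−1} = n·det(VᵀDiag(x)V), Brändén) runs on symmetric-function identities; with ≥ 2 distinct directions the weights are permanents of Y-minors (injective maps), exactly where product/derivative tricks produce products (maps with repetition).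
sources: arXiv:1208.1443, arXiv:1204.2997, arXiv:math/0510452, arXiv:1711.11497
[crux] FORK DECIDER (card H−, blindness): there is c such that for all n, r and all entrywise
nonnegative Y ∈ ℝ^{n×n} the closed cone {x ∈ ℝ^n : Q_{n,r,Y}(x + τ𝟙) ≠ 0 for all τ > 0} equals {x :
∃ y ∈ ℝ^p, A(x,y) + B ⪰ 0} for some m ≤ n^c + c, some p, a linear A into m×m real matrices and a
constant B. Proving it extends Saunderson–Parrilo from one derivative direction to mixed nonnegative
directions and KILLS the route (EasyRefutesHard; barrier entry "HyperbolicBlindness"); refuting it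
is the first rung of H+ (a superpolynomial shadow-size lower bound for permanental cones).
[difficulty: L] -/
@[route_item "route-ValiantsHypothesis-PermanentalCones"]
def PermanentalConesEasy : Prop :=
  ∃ c : ℕ, ∀ (n r : ℕ) (Y : Matrix (Fin n) (Fin n) ℝ), (∀ i j, 0 ≤ Y i j) → ∀ P : MvPolynomial (Fin n) ℝ, P = (Matrix.of fun i j : Fin n => if (i : ℕ) < r then MvPolynomial.C (Y i j) else MvPolynomial.X j).permanent → ∃ m ≤ n ^ c + c, ∃ (p : ℕ) (A : (Fin n → ℝ) × (Fin p → ℝ) →ₗ[ℝ] Matrix (Fin m) (Fin m) ℝ) (B : Matrix (Fin m) (Fin m) ℝ), ∀ x : Fin n → ℝ, (∀ τ : ℝ, 0 < τ → MvPolynomial.eval (fun j => x j + τ) P ≠ 0) ↔ ∃ y : Fin p → ℝ, (A (x, y) + B).PosSemidef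

/-- item stmt-ValiantsHypothesis-8653 · crux · rank 3 · open · by planner
why it might fail: Contains the projected Lax conjecture (every hyperbolic f is det of an affine pencil), open beyond Nash-smooth cones (Netzer–Sanyal, Scheiderer 2025: no size control); GKKP symmetrisation is never definite; one pencil family with hyperbolic determinants and non-qp shadow cones kills it.
sources: arXiv:1208.0441, arXiv:2509.17121, arXiv:1007.3804, arXiv:1612.07048, arXiv:math/0306180, arXiv:1308.5560
[crux] TRANSFER, PENCIL FORM (uniform complexity version of the projected Lax conjecture): there is
c such that for every real N×N matrix M of affine-linear forms in s_1..s_n whose determinant f is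
homogeneous and hyperbolic w.r.t. e (f(e) ≠ 0 and z ↦ f(x + z e) has only real zeros for all real
x), the closed cone {x : f(x + τe) ≠ 0 ∀ τ > 0} is a spectrahedral shadow {x : ∃ y, A(x,y) + B ⪰ 0}
of size m ≤ 2^((log₂ N + c)^c). Equivalently (M(e) normalised): linear spaces of real matrices with
only real eigenvalues have eigenvalue-nonnegativity cones of quasi-polynomial lifted-LMI size.
Implies HyperbolicVPShadow through the proved tree facts VP ⇒ dc quasi-polynomial and realification
(DetToVP). [difficulty: open-problem] -/
@[route_item "route-ValiantsHypothesis-PermanentalCones"]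
def HyperbolicDetShadow : Prop :=
  ∃ c : ℕ, ∀ (n N : ℕ) (f : MvPolynomial (Fin n) ℝ) (M : Matrix (Fin N) (Fin N) (MvPolynomial (Fin n) ℝ)) (e : Fin n → ℝ), Literature.Computability.AlgebraicComplexity.IsAffineDetRepr f M → (∃ d : ℕ, f.IsHomogeneous d) → (MvPolynomial.eval e f ≠ 0 ∧ ∀ (x : Fin n → ℝ) (z : ℂ), MvPolynomial.eval (fun j => (x j : ℂ) + z * (e j : ℂ)) (MvPolynomial.map (algebraMap ℝ ℂ) f) = 0 → z.im = 0) → ∃ m ≤ 2 ^ ((Nat.log 2 N + c) ^ c), ∃ (p : ℕ) (A : (Fin n → ℝ) × (Fin p → ℝ) →ₗ[ℝ] Matrix (Fin m) (Fin m) ℝ) (B : Matrix (Fin m) (Fin m) ℝ), ∀ x : Fin n → ℝ, (∀ τ : ℝ, 0 < τ → MvPolynomial.eval (x + τ • e) f ≠ 0) ↔ ∃ y : Fin p → ℝ, (A (x, y) + B).PosSemidef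

/-- item stmt-ValiantsHypothesis-8654 · crux · rank 4 · open · by planner
why it might fail: H− may hold (blindness); and no method bounds SHADOW size super-logarithmically for any explicit non-polyhedral cone (LRS is polyhedral, algebraic-degree bounds are O(log), RRSW counts dimension of generic perturbations — useless for an n²-parameter family).
sources: arXiv:1711.11497, arXiv:1411.6317, arXiv:1111.3164, arXiv:1705.06996, arXiv:1612.07048, doi:10.1145/3373207.3404010
[crux] H+ (card K1, H+ branch): there are r : ℕ → ℕ and entrywise nonnegative Y_n ∈ ℝ^{n×n} such
that every Q_n := per[(Y_n)_{rows<r n}; s^{(n−r n)}] is hyperbolic w.r.t. 𝟙 (Q_n(𝟙) ≠ 0 and only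
real zeros of z ↦ Q_n(x + z𝟙)) and for every c there is n such that the closed cone {x : Q_n(x + τ𝟙)
≠ 0 ∀ τ > 0} has NO description {x : ∃ y, A(x,y) + B ⪰ 0} with m ≤ 2^((log₂ n + c)^c). Existential
in Y_n on purpose: Q_n is a projection of per_n for ANY constants, so non-uniformity absorbs
explicitness (PermanentalInVP). [deps: PermanentalConesEasy] [difficulty: open-problem] -/
@[route_item "route-ValiantsHypothesis-PermanentalCones", crux]
def PermanentalConeHard : Prop :=
  ∃ (r : ℕ → ℕ) (Y : ∀ n : ℕ, Matrix (Fin n) (Fin n) ℝ), (∀ n i j, 0 ≤ Y n i j) ∧ ∀ P : ∀ n : ℕ, MvPolynomial (Fin n) ℝ, (∀ n, P n = (Matrix.of fun i j : Fin n => if (i : ℕ) < r n then MvPolynomial.C (Y n i j) else MvPolynomial.X j).permanent) → (∀ n, MvPolynomial.eval (fun _ => (1 : ℝ)) (P n) ≠ 0 ∧ ∀ (x : Fin n → ℝ) (z : ℂ), MvPolynomial.eval (fun j => (x j : ℂ) + z) (MvPolynomial.map (algebraMap ℝ ℂ) (P n)) = 0 → z.im = 0) ∧ ∀ c : ℕ,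 ∃ n : ℕ, ∀ m ≤ 2 ^ ((Nat.log 2 n + c) ^ c), ∀ (p : ℕ) (A : (Fin n → ℝ) × (Fin p → ℝ) →ₗ[ℝ] Matrix (Fin m) (Fin m) ℝ) (B : Matrix (Fin m) (Fin m) ℝ), ¬ ∀ x : Fin n → ℝ, (∀ τ : ℝ, 0 < τ → MvPolynomial.eval (fun j => x j + τ) (P n) ≠ 0) ↔ ∃ y : Fin p → ℝ, (A (x, y) + B).PosSemidef

/-- item stmt-ValiantsHypothesis-8655 · crux · rank 5 · open · by planner
why it might fail: ¬HT = a VP family with hard shadow cones is the MonotoneGap analogue; hyperbolicity is invisible gate by gate, so no inductive proof exists, and constant families already make HT contain the projected Lax conjecture (open for singular cones).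
sources: arXiv:1711.11497, arXiv:1208.0441, arXiv:2509.17121, doi:10.1145/3373207.3404010, Burgisser2000
[crux] HT, FAMILY FORM (card K2; the weakest transfer the assembly consumes): for every p-family f_n
∈ ℝ[s_1..s_{v(n)}] of homogeneous polynomials hyperbolic w.r.t. directions e_n whose
complexification is a VP_ℂ family, there is c with: for all n the closed cone {x : f_n(x + τ e_n) ≠
0 ∀ τ > 0} is a spectrahedral shadow of size m ≤ 2^((log₂ n + c)^c). Prove it via
HyperbolicDetShadow + DetToVP; refute it by a VP family (e.g. few-direction derivative cones
D_{y}D_{y'}e_n, r = O(log n) permanental families, pencil determinants) with non-qp shadow cones.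
[deps: HyperbolicDetShadow] [difficulty: open-problem] -/
@[route_item "route-ValiantsHypothesis-PermanentalCones", crux]
def HyperbolicVPShadow : Prop :=
  ∀ (v : ℕ → ℕ) (f : ∀ n : ℕ, MvPolynomial (Fin (v n)) ℝ) (e : ∀ n : ℕ, Fin (v n) → ℝ), Literature.Computability.AlgebraicComplexity.IsVPFamily (fun n => MvPolynomial.map (algebraMap ℝ ℂ) (f n)) → (∀ n, ∃ d : ℕ, (f n).IsHomogeneous d) → (∀ n, MvPolynomial.eval (e n) (f n) ≠ 0 ∧ ∀ (x : Fin (v n) → ℝ) (z : ℂ), MvPolynomial.eval (fun j => (x j : ℂ) + z * (e n j : ℂ)) (MvPolynomial.map (algebraMap ℝ ℂ) (f n)) = 0 → z.im = 0) → ∃ c : ℕ, ∀ n : ℕ, ∃ m ≤ 2 ^ ((Nat.log 2 n + c) ^ c), ∃ (p : ℕ) (A : (Fin (v n) → ℝ) × (Fin p → ℝ) →ₗ[ℝ] Matrix (Fin m) (Fin m) ℝ) (B : Matrix (Fin m) (Fin m) ℝ), ∀ x : Fin (v n) → ℝ, (∀ τ : ℝ, 0 < τ → MvPolynomial.eval (x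 + τ • e n) (f n) ≠ 0) ↔ ∃ y : Fin p → ℝ, (A (x, y) + B).PosSemidef

/-- item stmt-ValiantsHypothesis-8656 · support · rank 9 · closed · proved by Summit.ValiantsHypothesis.ValiantsHypothesis.Theorems.easyRefutesHard_proof @ 44e175075bcb (prover) · by planner
sources: arXiv:1208.1443
[support] kill chain: uniform polynomial-size shadows for all nonnegative permanental cones refute
H+ (n^c + c ≤ 2^((log₂ n + c')^c') for a suitable c', instantiate at the witness family).
[difficulty: provable-now] -/
@[route_item "route-ValiantsHypothesis-PermanentalCones"]
def EasyRefutesHard : Prop :=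
  PermanentalConesEasy → ¬ PermanentalConeHard

-- `EasyRefutesHard` holds: proved by `Summit.ValiantsHypothesis.ValiantsHypothesis.Theorems.easyRefutesHard_proof` @ 44e175075bcb (its module imports this route file, so no `_holds` link can be stated here).

/-- item stmt-ValiantsHypothesis-8657 · support · rank 9 · closed · proved by Summit.ValiantsHypothesis.ValiantsHypothesis.Theorems.permanentalCones_detToVP_proof @ 8bdd51a99639 (prover) · by planner
sources: BurgisserClausenShokrollahi1997, Burgisser2000, arXiv:1007.3804
[support] pencil form ⇒ family form: for a real family f with complexification in VP_ℂ, dc_ℂ(f_n) ≤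
2^((log₂ n + a)^a) (isQPBounded_determinantalComplexity_of_isVPFamily_holds,
hasDetRepr_determinantalComplexity_holds, both proved); realify the complex affine pencil P + iQ to
the real 2N×2N pencil [[P, −Q],[Q, P]] whose determinant is f_n² (block-triangularisation over ℂ);
f_n² is homogeneous, hyperbolic w.r.t. e_n with the same closed cone as f_n; apply
HyperbolicDetShadow and compose the two quasi-polynomial bounds. [difficulty: provable-now] -/
@[route_item "route-ValiantsHypothesis-PermanentalCones"]
def DetToVP : Prop :=
  HyperbolicDetShadow → HyperbolicVPShadow

-- `DetToVP` holds: proved by `Summit.ValiantsHypothesis.ValiantsHypothesis.Theorems.permanentalCones_detToVP_proof` @ 8bdd51a99639 (its module imports this route file, so no `_holds` link can be stated here).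

/-- item stmt-ValiantsHypothesis-8658 · support · rank 9 · closed · proved by Summit.ValiantsHypothesis.ValiantsHypothesis.Theorems.permanentalHyperbolic_proof @ cd3dd94efd49 (prover) · by planner
sources: arXiv:0911.3569, arXiv:0809.0401, arXiv:math/0510452
[support] Gårding/Lieb–Sokal for the witnesses (card P1): for entrywise nonnegative Y, Q =
per[Y_{rows<r}; s^{(n−r)}] is real stable (Π s_j is stable; D_y = Σ y_j ∂_j with y ≥ 0 preserves
stability or kills the polynomial: for Im s > 0 the zeros t_k of t ↦ Q(s + t y) have Im t_k < 0 and
D_yQ(s) = −Q(s)·Σ 1/t_k ≠ 0), hence if Q(𝟙) ≠ 0 then z ↦ Q(x + z𝟙) has only real zeros (conjugation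
symmetry for Im z < 0). [difficulty: provable-now] -/
@[route_item "route-ValiantsHypothesis-PermanentalCones"]
def PermanentalHyperbolic : Prop :=
  ∀ (n r : ℕ) (Y : Matrix (Fin n) (Fin n) ℝ), (∀ i j, 0 ≤ Y i j) → ∀ P : MvPolynomial (Fin n) ℝ, P = (Matrix.of fun i j : Fin n => if (i : ℕ) < r then MvPolynomial.C (Y i j) else MvPolynomial.X j).permanent → MvPolynomial.eval (fun _ => (1 : ℝ)) P ≠ 0 → ∀ (x : Fin n → ℝ) (z : ℂ), MvPolynomial.eval (fun j => (x j : ℂ) + z) (MvPolynomial.map (algebraMap ℝ ℂ) P) = 0 → z.im = 0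

-- `PermanentalHyperbolic` holds: proved by `Summit.ValiantsHypothesis.ValiantsHypothesis.Theorems.permanentalHyperbolic_proof` @ cd3dd94efd49 (its module imports this route file, so no `_holds` link can be stated here).

/-- item stmt-ValiantsHypothesis-8659 · support · rank 9 · closed · proved by Summit.ValiantsHypothesis.ValiantsHypothesis.Theorems.PermanentalCones.permanentalInVP_proof @ cdab78711d30 (prover) · by planner
sources: Valiant1979, Burgisser2000
[support] projection closure (card P1, completeness direction not needed): the complexification of
per[(Y_n)_{rows<r n}; s^{(n−r n)}] is aeval of perPoly (Fin n) ℂ under (i,j) ↦ C (Y n i j) (i < r n)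
/ X j (else), a Valiant projection with t = id; it is a p-family (n variables, total degree ≤ n);
hence per ∈ VP_ℂ (IsVPFamily) gives IsVPFamily of the permanental family for EVERY choice of r, Y
(IsVPFamily.of_isPProjection_holds). [difficulty: provable-now] -/
@[route_item "route-ValiantsHypothesis-PermanentalCones", crux]
def PermanentalInVP : Prop :=
  Literature.Computability.AlgebraicComplexity.IsVPFamily (fun n => Literature.Computability.AlgebraicComplexity.perPoly (Fin n) ℂ) → ∀ (r : ℕ → ℕ) (Y : ∀ n : ℕ, Matrix (Fin n) (Fin n) ℝ), Literature.Computability.AlgebraicComplexity.IsVPFamily (fun n => MvPolynomial.map (algebraMap ℝ ℂ) (Matrix.of fun i j : Fin n => if (i : ℕ) < r n then MvPolynomial.C (Y n i j) else MvPolynomial.X j).permanent)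

-- `PermanentalInVP` holds: proved by `Summit.ValiantsHypothesis.ValiantsHypothesis.Theorems.PermanentalCones.permanentalInVP_proof` @ cdab78711d30 (its module imports this route file, so no `_holds` link can be stated here).

/-- item stmt-ValiantsHypothesis-8660 · assembly · rank 1 · closed · proved by Summit.ValiantsHypothesis.ValiantsHypothesis.Theorems.PermanentalCones.assembly_proof @ f667b2aa9262 (prover) · by planner
sources: Valiant1979, Burgisser2000, arXiv:math/0510452
[assembly] PermanentalConeHard → HyperbolicVPShadow → ValiantsHypothesis (hub facts, projection
closure and the renaming bridge are proved theorems used inside the proof). -/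
@[route_item "route-ValiantsHypothesis-PermanentalCones"]
def Assembly : Prop :=
  PermanentalConeHard → HyperbolicVPShadow → ValiantsHypothesis

-- `Assembly` holds: proved by `Summit.ValiantsHypothesis.ValiantsHypothesis.Theorems.PermanentalCones.assembly_proof` @ f667b2aa9262 (its module imports this route file, so no `_holds` link can be stated here).

/-! D-0027 §2.1 — DECIDING THEOREM (planner-authored via `route open/edit --closes-file`; by planner-rbadge-ValiantsHypothesis-PermanentalC-7ef32e5a-g2-0 2026-08-15T16:23:40Z):
its hypotheses are this route's items and its conclusion the sub-problem Statement (glue_lint), and it elaborates with this file. -/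

@[closes "route-ValiantsHypothesis-PermanentalCones"] theorem closes (h_PermanentalConeHard : PermanentalConeHard)
    (h_HyperbolicVPShadow : HyperbolicVPShadow) (h_PermanentalInVP : PermanentalInVP) :
    _root_.ValiantsHypothesis := by
  show Literature.Computability.AlgebraicComplexity.VP ℂ ≠
    Literature.Computability.AlgebraicComplexity.VNP ℂ
  intro hEq
  -- VP = VNP puts the permanent family in VP (Valiant: PER ∈ VNP; bundling bridge).
  have hVNP := Literature.Computability.AlgebraicComplexity.perFamily_mem_VNP_holds ℂ
  have hVP : Literature.Computability.AlgebraicComplexity.perFamily ℂ ∈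
      Literature.Computability.AlgebraicComplexity.VP ℂ := by
    rw [hEq]; exact hVNP
  have hper : Literature.Computability.AlgebraicComplexity.IsVPFamily
      (fun n => Literature.Computability.AlgebraicComplexity.perPoly (Fin n) ℂ) :=
    (Literature.Computability.AlgebraicComplexity.mem_VP_ofFintype_iff_holds _).1 hVP
  -- The H+ witnesses: directions r, nonnegative constants Y, permanental family P.
  obtain ⟨r, Y, hY, hH⟩ := h_PermanentalConeHard
  let P : ∀ n : ℕ, MvPolynomial (Fin n) ℝ := fun n =>
    (Matrix.of fun i j : Fin n =>
      if (i : ℕ) < r n then MvPolynomial.C (Y n i j) else MvPolynomial.X j).permanent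
  obtain ⟨hhyp, hnone⟩ := hH P (fun n => rfl)
  -- Projection closure (item PermanentalInVP): per ∈ VP ⇒ the permanental family is in VP.
  have hfam : Literature.Computability.AlgebraicComplexity.IsVPFamily
      (fun n => MvPolynomial.map (algebraMap ℝ ℂ) (P n)) := h_PermanentalInVP hper r Y
  -- Homogeneity: every summand of the permanent has degree #{j : r n ≤ j}.
  have hhom : ∀ n, ∃ d : ℕ, (P n).IsHomogeneous d := by
    intro n
    refine ⟨∑ j : Fin n, (if (j : ℕ) < r n then 0 else 1), ?_⟩
    show MvPolynomial.IsHomogeneous (Matrix.permanent _) _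
    unfold Matrix.permanent
    refine MvPolynomial.IsHomogeneous.sum _ _ _ (fun σ _ => ?_)
    have hprod := MvPolynomial.IsHomogeneous.prod (Finset.univ : Finset (Fin n))
      (fun i => (Matrix.of fun i j : Fin n =>
        if (i : ℕ) < r n then MvPolynomial.C (Y n i j) else MvPolynomial.X j) (σ i) i)
      (fun i => if ((σ i : Fin n) : ℕ) < r n then 0 else 1) (fun i _ => ?_)
    · rwa [Equiv.sum_comp σ (fun j : Fin n => if (j : ℕ) < r n then (0 : ℕ) else 1)] at hprod
    · simp only [Matrix.of_apply]
      split_ifs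
      · exact MvPolynomial.isHomogeneous_C _ _
      · exact MvPolynomial.isHomogeneous_X _ _
  -- Hyperbolicity w.r.t. 𝟙 in the form HT consumes (z * 1 = z).
  have hhyp' : ∀ n, MvPolynomial.eval ((fun (n : ℕ) (_ : Fin n) => (1 : ℝ)) n) (P n) ≠ 0 ∧
      ∀ (x : Fin n → ℝ) (z : ℂ), MvPolynomial.eval
        (fun j => (x j : ℂ) + z * (((fun (n : ℕ) (_ : Fin n) => (1 : ℝ)) n j : ℝ) : ℂ))
          (MvPolynomial.map (algebraMap ℝ ℂ) (P n)) = 0 → z.im = 0 := by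
    intro n
    refine ⟨(hhyp n).1, fun x z hz => (hhyp n).2 x z ?_⟩
    simpa using hz
  -- HT (item HyperbolicVPShadow) at v = id, f = P, e = 𝟙: qp-size shadows for every n …
  obtain ⟨c, hc⟩ := h_HyperbolicVPShadow (fun n => n) P (fun n _ => 1) hfam hhom hhyp'
  -- … while H+ at this c gives an n with no such shadow: contradiction.
  obtain ⟨n, hn⟩ := hnone c
  obtain ⟨m, hm, p, A, B, hrep⟩ := hc n
  refine hn m hm p A B (fun x => Iff.trans (forall_congr' fun τ => ?_) (hrep x))
  have e1 : (fun j : Fin n => x j + τ) = x + τ • (fun _ : Fin n => (1 : ℝ)) := by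
    funext j; simp
  rw [e1]

end Summit.ValiantsHypothesis.ValiantsHypothesis.Theses.PermanentalCones
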